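import Literature.MathematicalPhysics.QuantumFieldTheory.Balaban1983to89.B1Eq324BenfattoSect5Eq515
import HarnessLib

/-!
# `Balaban1983to89.B1Eq324BenfattoSect5Eq535` — [BenfattoEtAl1978] §5 p. 159, (5.35) «use the Markov property», BACKWARDS, with the error of (5.34):
# the factorised per-box form with weights `Ψ′₁ + Ψ₂` re-assembles into the next step's (5.12)-shaped integral `∫ Π_Δχ̂^{γb}_Δ e^{H_{Γ̄₁}} dP̂₀`,
# PROVED for the tree's objects

statement-level skeleton of published theorems with citation tags; proofs where landed; nothing here is a claim about the
Yang–Mills mass gap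

WHY THIS MODULE (cell `pub-ymgap`, seat `dag-n08-d` gen 9, INTENT-29; node N08 [Balaban1985UV3]; the [BenfattoEtAl1978] source chain behind the
(α)-row `h324c`; layer 2 of the assembly census `N08-BCG-ASSEMBLY-MAP.md` v1, second half — the sequel of `…Sect5Eq515`, split off for the 1 000-line rule).
Print, p. 159 (render `lit-balaban-typer/renders/benfatto1978-cmp59/bcg_p159_s3.png`, read first-hand): *"We now bound H_{Γ₄(□),Γ₂(□)∖Γ₃(□)} as usual [see
(5.24)] use the Markov property of P̄ and remark that if Γ̄₁ = ⋃_{□∈Q^b}[Γ₁(□)∪Γ₂(□)∪Γ₄(□)] … (5.34) and obtain [(5.12)] ≧ (∫P̄(dz)Π_{□∈Q^b}χ^□_{γb} exp H_{Γ̄₁})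
·exp{Σ_{k₁+k₂≦t, k₁>0} (1/k₁!k₂!) Σ_□ Ê₀^T(Ψ″₁,Ψ′₁;k₁,k₂)} exp(error) (5.35) where the error can be described as after (5.31); Now we study the integral and
remark that it has the same structure as (5.12) with J replaced by Γ̄₁ and b by γb."*

WHAT IS PROVED (standard axioms; no `sorry`; no definition).  With the objects of `…Sect5Eq515` (`smallFieldOn`, `out`, the factorisation identity
`integral_boxes_factorise_eq`) and `…Sect5Eq524`/`…Sect5Eq534` (`psi1p = Ψ′₁`, `psi2 = Ψ₂`, `corridorsBar = Γ̄₁`, the (5.34) error bound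
`abs_hamiltonian_corridorsBar_sub_sum_psi_le`): `card_le_of_subset_box`, `abs_interaction_le_local` (`|H_{R,S}| ≤ 3s₁Ab^DL^d` for `R, S ⊆ □` from
`|z_Δ| ≤ b` on `J ∩ □`), `abs_psi1p_add_psi2_le_local` (`|Ψ′₁ + Ψ₂| ≤ 8s₁Ab^DL^d`), `psi1p_add_psi2_congr_eqOn`, `measurable_psi1p_add_psi2`,
`mem_smallFieldOn_of_mem_smallFieldSet`, ★★ `exp_neg_err_mul_integral_cutoff_corridorsBar_le` :
`e^{−err}·∫ Π_Δχ̂^{γb}_Δ e^{H_{Γ̄₁}} dP̂₀ ≤ ∫ χ^{Γ₁}_{γb}(ξ)e^{H_{Γ₁}(ξ)}·[∫χ^{out}_b dP̄_ξ]·Π_{□∈B}[∫ χ^{Γ₁(□)}_{γb}χ^□_b e^{Ψ′₁+Ψ₂} dP̄_ξ] dP̂₀(ξ)`,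
`err = s₁Ab^D(e^{−(ϰ/4)w}|Γ̄₁| + e^{−(ϰ/4)v}|B|L^d)` (`L ≥ 1`, `1 ≤ w`, `v ≤ w`, `γ ≤ 1 ≤ b`, `J ⊆ I`, extension convention + coefficient bound).
HONEST SCOPE.  The structural half of (5.35) only: the factor `exp{Σ Ê₀^T(Ψ″₁,Ψ′₁)}` and the per-box errors (5.25)–(5.33) come from the per-box line
(n08-b's `…Sect5PerBox`), the iteration over the displaced pavements and `b*` are not here; `Π_{□∈Q^b}χ^□_{γb}` is `Π_Δχ̂^{γb}_Δ = smallFieldSet I (γb)`;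
count-neutral for N08; `BasicLemmaPrinted` NOT discharged; nothing about d = 4, the continuum, OS axioms, a mass gap or the Clay problem.
-/

noncomputable section

open Finset MeasureTheory
open scoped BigOperators

namespace Literature.MathematicalPhysics.QuantumFieldTheory.Balaban1983to89.B1Eq324BenfattoSect5Eq535

open _root_.MeasureTheory _root_.ProbabilityTheory
open Literature.MathematicalPhysics.QuantumFieldTheory.Balaban1983to89.B3Sect3VectorSelfEnergy (ZSite unitVec)
open Literature.MathematicalPhysics.QuantumFieldTheory.Balaban1983to89.B1Eq324BenfattoLemma
open Literature.MathematicalPhysics.QuantumFieldTheory.Balaban1983to89.B1Eq324BenfattoAppendixA (cubeDist_nonneg distToRegion_nonneg)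
open Literature.MathematicalPhysics.QuantumFieldTheory.Balaban1983to89.B1Eq324BenfattoSect5Boxes
open Literature.MathematicalPhysics.QuantumFieldTheory.Balaban1983to89.B1Eq324BenfattoSect5Eq511
open Literature.MathematicalPhysics.QuantumFieldTheory.Balaban1983to89.B1Eq324BenfattoSect5Eq524
open Literature.MathematicalPhysics.QuantumFieldTheory.Balaban1983to89.B1Eq324BenfattoSect5Eq534
open Literature.MathematicalPhysics.QuantumFieldTheory.Balaban1983to89.B1Eq324BenfattoSect5Eq515
open Literature.MathematicalPhysics.QuantumFieldTheory.Balaban1983to89.B1Eq324BenfattoSect5SlotMoments (distToRegion_eq_zero_of_mem)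

variable {d : ℕ}

/-! ## §1  (5.35) «use the Markov property», backwards: `W_□ = Ψ′₁ + Ψ₂` and the error of (5.34) -/

section Eq535

variable {α β : ℝ} {s D : ℕ} {κ : ℝ} {a : Coef d} {J I : Finset (B1Eq324BenfattoLemma.Site d)} {L w v : ℕ}
  {m : B1Eq324BenfattoLemma.Site d} {B : Finset (B1Eq324BenfattoLemma.Site d)} {γ b A : ℝ}

/-- `|□_m ∩ T| ≤ L^d` for `T ⊆ □_m`. [cite: BenfattoEtAl1978, (5.7) p.154] -/
theorem card_le_of_subset_box {T : Finset (B1Eq324BenfattoLemma.Site d)} (hT : T ⊆ box L m) : T.card ≤ L ^ d :=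
  (Finset.card_le_card hT).trans (by rw [← shrink_zero]; exact card_shrink_le L m 0)

/-- **Local a-priori size of an interaction inside a tessera**: for `R, S ⊆ □`, `|H_{R,S}(z)| ≤ 3s₁·A·b^D·L^d` when `|z_Δ| ≤ b` on `J ∩ □`
(`H_{R,S} = H_{R∪S} − H_R − H_S`, each bounded by `abs_hamiltonian_le_local`). [cite: BenfattoEtAl1978, (5.6) p.154, (5.15) i) p.155] -/
theorem abs_interaction_le_local (hκ : 0 < κ) (hJ : CoefSupportedIn a J) (hA0 : 0 ≤ A)
    (hA : ∀ p ∈ Finset.Icc 1 s, ∀ (Δ : Fin p → B1Eq324BenfattoLemma.Site d), (∀ i, Δ i ∈ J) →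
      ∀ n ∈ admissible p D, |a p Δ n| ≤ A)
    {R S : Finset (B1Eq324BenfattoLemma.Site d)} (hR : R ⊆ box L m) (hS : S ⊆ box L m) {z : B1Eq324BenfattoLemma.Site d → ℝ} (hb : 1 ≤ b)
    (hz : ∀ x ∈ J, x ∈ box L m → |z x| ≤ b) :
    |interaction s D κ a R S z| ≤ 3 * (s1Const s D d κ * A * b ^ D * (L : ℝ) ^ d) := by
  have hs : 0 ≤ s1Const s D d κ * A * b ^ D := by
    have := s1Const_nonneg hκ s D d
    have : (0 : ℝ) ≤ b := zero_le_one.trans hb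
    positivity
  have hT : ∀ T : Finset (B1Eq324BenfattoLemma.Site d), T ⊆ box L m →
      |hamiltonian s D κ a T z| ≤ s1Const s D d κ * A * b ^ D * (L : ℝ) ^ d := by
    intro T hTb
    refine (abs_hamiltonian_le_local hκ hJ hA0 hA T hb fun x hx hxT => hz x hx (hTb hxT)).trans ?_
    exact mul_le_mul_of_nonneg_left (by exact_mod_cast card_le_of_subset_box hTb) hs
  rw [interaction]
  calc |hamiltonian s D κ a (R ∪ S) z - hamiltonian s D κ a R z - hamiltonian s D κ a S z|
      ≤ |hamiltonian s D κ a (R ∪ S) z| + |hamiltonian s D κ a R z| + |hamiltonian s D κ a S z| := abs_sub_three _ _ _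
    _ ≤ _ := by
        have h1 := hT (R ∪ S) (Finset.union_subset hR hS)
        have h2 := hT R hR
        have h3 := hT S hS
        linarith
  where
  /-- `|a − b − c| ≤ |a| + |b| + |c|`. -/
  abs_sub_three (x y u : ℝ) : |x - y - u| ≤ |x| + |y| + |u| := by
    calc |x - y - u| ≤ |x - y| + |u| := abs_sub _ _
      _ ≤ |x| + |y| + |u| := by linarith [abs_sub x y]

/-- **Local a-priori size of the exponent of (5.33)**: `|Ψ′₁(z) + Ψ₂(z)| ≤ 8s₁·A·b^D·L^d` when `|z_Δ| ≤ b` on `J ∩ □` (`Ψ′₁ = H_{Γ₄} + H_{Γ₄,Γ₃}`,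
`Ψ₂ = H_{Γ₁(□),Γ₂(□)} + H_{Γ₂(□)}`, all regions inside `□`). [cite: BenfattoEtAl1978, (5.23), (5.27) p.157, (5.33) p.159] -/
theorem abs_psi1p_add_psi2_le_local (hκ : 0 < κ) (hJ : CoefSupportedIn a J) (hA0 : 0 ≤ A)
    (hA : ∀ p ∈ Finset.Icc 1 s, ∀ (Δ : Fin p → B1Eq324BenfattoLemma.Site d), (∀ i, Δ i ∈ J) →
      ∀ n ∈ admissible p D, |a p Δ n| ≤ A)
    {z : B1Eq324BenfattoLemma.Site d → ℝ} (hb : 1 ≤ b) (hz : ∀ x ∈ J, x ∈ box L m → |z x| ≤ b) :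
    |psi1p s D κ a L w v m z + psi2 s D κ a L w m z| ≤ 8 * (s1Const s D d κ * A * b ^ D * (L : ℝ) ^ d) := by
  have hs : 0 ≤ s1Const s D d κ * A * b ^ D := by
    have := s1Const_nonneg hκ s D d
    have : (0 : ℝ) ≤ b := zero_le_one.trans hb
    positivity
  have h4 : frame4 L w v m ⊆ box L m := (frame4_subset_core L w v m).trans (by rw [core]; exact shrink_subset_box L m _)
  have h3 : frame3 L w v m ⊆ box L m := by
    rw [frame3, annulus]
    exact Finset.sdiff_subset.trans (shrink_subset_box L m _)
  have h2 : frame2 L w m ⊆ box L m := by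
    rw [frame2]
    exact Finset.sdiff_subset.trans (shrink_subset_box L m _)
  have h1 : frame1 L w m ⊆ box L m := by
    rw [frame1]
    exact Finset.sdiff_subset
  have hT : ∀ T : Finset (B1Eq324BenfattoLemma.Site d), T ⊆ box L m →
      |hamiltonian s D κ a T z| ≤ s1Const s D d κ * A * b ^ D * (L : ℝ) ^ d := by
    intro T hTb
    refine (abs_hamiltonian_le_local hκ hJ hA0 hA T hb fun x hx hxT => hz x hx (hTb hxT)).trans ?_
    exact mul_le_mul_of_nonneg_left (by exact_mod_cast card_le_of_subset_box hTb) hs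
  have e4 := hT _ h4
  have e2 := hT _ h2
  have i43 := abs_interaction_le_local hκ hJ hA0 hA h4 h3 hb hz (s := s) (D := D)
  have i12 := abs_interaction_le_local hκ hJ hA0 hA h1 h2 hb hz (s := s) (D := D)
  rw [psi1p, psi2]
  calc |hamiltonian s D κ a (frame4 L w v m) z + interaction s D κ a (frame4 L w v m) (frame3 L w v m) z +
        (interaction s D κ a (frame1 L w m) (frame2 L w m) z + hamiltonian s D κ a (frame2 L w m) z)|
      ≤ |hamiltonian s D κ a (frame4 L w v m) z| + |interaction s D κ a (frame4 L w v m) (frame3 L w v m) z| +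
        (|interaction s D κ a (frame1 L w m) (frame2 L w m) z| + |hamiltonian s D κ a (frame2 L w m) z|) :=
        (abs_add_le _ _).trans (add_le_add (abs_add_le _ _) (abs_add_le _ _))
    _ ≤ _ := by linarith

/-- `Ψ′₁ + Ψ₂` reads `□` only. [cite: BenfattoEtAl1978, (5.23), (5.27) p.157] -/
theorem psi1p_add_psi2_congr_eqOn (L w v : ℕ) (m : B1Eq324BenfattoLemma.Site d) {z z' : B1Eq324BenfattoLemma.Site d → ℝ}
    (h : ∀ x ∈ box L m, z x = z' x) :
    psi1p s D κ a L w v m z + psi2 s D κ a L w m z = psi1p s D κ a L w v m z' + psi2 s D κ a L w m z' := by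
  have hT : ∀ T : Finset (B1Eq324BenfattoLemma.Site d), T ⊆ box L m → hamiltonian s D κ a T z = hamiltonian s D κ a T z' :=
    fun T hTb => hamiltonian_congr_eqOn T fun x hx => h x (hTb hx)
  have h4 : frame4 L w v m ⊆ box L m := (frame4_subset_core L w v m).trans (by rw [core]; exact shrink_subset_box L m _)
  have h3 : frame3 L w v m ⊆ box L m := by
    rw [frame3, annulus]
    exact Finset.sdiff_subset.trans (shrink_subset_box L m _)
  have h2 : frame2 L w m ⊆ box L m := by
    rw [frame2]
    exact Finset.sdiff_subset.trans (shrink_subset_box L m _)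
  have h1 : frame1 L w m ⊆ box L m := by
    rw [frame1]
    exact Finset.sdiff_subset
  simp only [psi1p, psi2, interaction]
  rw [hT _ h4, hT _ (Finset.union_subset h4 h3), hT _ h3, hT _ (Finset.union_subset h1 h2), hT _ h1, hT _ h2]

/-- `Ψ′₁ + Ψ₂` is measurable. [cite: BenfattoEtAl1978, (5.23), (5.27) p.157] -/
theorem measurable_psi1p_add_psi2 (L w v : ℕ) (m : B1Eq324BenfattoLemma.Site d) :
    Measurable fun z => psi1p s D κ a L w v m z + psi2 s D κ a L w m z := by
  unfold psi1p psi2 interaction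
  have h := fun T : Finset (B1Eq324BenfattoLemma.Site d) => measurable_hamiltonian (s := s) (D := D) (κ := κ) (a := a) T
  exact ((h _).add (((h _).sub (h _)).sub (h _))).add ((((h _).sub (h _)).sub (h _)).add (h _))

/-- On `Π_Δχ̂_Δ` with threshold `γb` every regional cut-off of (5.13)/(5.15) with threshold `≥ γb` is `1`. [cite: BenfattoEtAl1978, (5.14) p.155] -/
theorem mem_smallFieldOn_of_mem_smallFieldSet {R : Set (B1Eq324BenfattoLemma.Site d)} {c c' : ℝ} (hcc : c ≤ c')
    {z : B1Eq324BenfattoLemma.Site d → ℝ} (hz : z ∈ smallFieldSet I c) : z ∈ smallFieldOn R I c' := by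
  rw [smallFieldSet_eq_smallFieldOn_univ] at hz
  exact smallFieldOn_subset_of_le R I hcc (smallFieldOn_mono (Set.subset_univ R) I c hz)

/-- **(5.35) — «USE THE MARKOV PROPERTY», BACKWARDS, WITH THE ERROR OF (5.34)**: p. 159, *"We now bound H_{Γ₄(□),Γ₂(□)∖Γ₃(□)} as usual … use the
Markov property of P̄ and remark that … (5.34) and obtain [(5.12)] ≧ (∫P̄(dz)Π_{□∈Q^b}χ^□_{γb} exp H_{Γ̄₁})·exp{…}exp(error) (5.35)"*.  PROVED for the
tree's objects, the structural half: with the per-box weights `W_□ = Ψ′₁(□) + Ψ₂(□)` (the exponent left in each box after (5.33)), the factorised form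
re-assembles, up to the (5.34) error `err = s₁Ab^D(e^{−(ϰ/4)w}|Γ̄₁| + e^{−(ϰ/4)v}|B|L^d)` (`Sect5Eq534.abs_hamiltonian_corridorsBar_sub_sum_psi_le`), into the
(5.12)-shaped integral of the NEXT step (`J` replaced by `Γ̄₁`, `b` by `γb`):
`e^{−err}·∫ Π_Δχ̂^{γb}_Δ e^{H_{Γ̄₁}} dP̂₀ ≤ ∫ χ^{Γ₁}_{γb}(ξ)e^{H_{Γ₁}(ξ)}·[∫χ^{out}_b dP̄_ξ]·Π_{□∈B}[∫ χ^{Γ₁(□)}_{γb}χ^□_b e^{Ψ′₁+Ψ₂} dP̄_ξ] dP̂₀(ξ)`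
(`v ≤ w`, `γ ≤ 1 ≤ b`).  The cumulant factor `exp{Σ Ê₀^T(Ψ″₁,Ψ′₁)}` and the per-box errors of (5.25)–(5.33) are the per-box line's.
[cite: BenfattoEtAl1978, §5 (5.34)–(5.35) p.159] -/
theorem exp_neg_err_mul_integral_cutoff_corridorsBar_le (hα : 0 < α) (hβ : 0 < β) (hκ : 0 < κ) (hJ : CoefSupportedIn a J) (hA0 : 0 ≤ A)
    (hA : ∀ p ∈ Finset.Icc 1 s, ∀ (Δ : Fin p → B1Eq324BenfattoLemma.Site d), (∀ i, Δ i ∈ J) →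
      ∀ n ∈ admissible p D, |a p Δ n| ≤ A)
    (hJI : J ⊆ I) (hL : 0 < L) (hw : 1 ≤ w) (hv : v ≤ w) (B : Finset (B1Eq324BenfattoLemma.Site d)) (hγ : γ ≤ 1) (hb : 1 ≤ b) :
    Real.exp (-(s1Const s D d κ * A * b ^ D *
          (Real.exp (-(κ / 4 * w)) * (corridorsBar L w v B).card + Real.exp (-(κ / 4 * v)) * (B.card * (L : ℝ) ^ d)))) *
        ∫ z, cutoffBoltzmann (hamiltonian s D κ a (corridorsBar L w v B)) I (γ * b) z ∂P0 d α β
      ≤ ∫ ξ, (smallFieldOn (corridors L w B : Set (B1Eq324BenfattoLemma.Site d)) I (γ * b)).indicator (fun _ => (1 : ℝ)) ξ *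
            Real.exp (hamiltonian s D κ a (corridors L w B) ξ) *
          ((∫ z, (smallFieldOn (out L B) I b).indicator (fun _ => (1 : ℝ)) z ∂condField d α β (corridors L w B) ξ) *
            ∏ m ∈ B, ∫ z, (smallFieldOn (frame1 L w m : Set (B1Eq324BenfattoLemma.Site d)) I (γ * b)).indicator (fun _ => (1 : ℝ)) z *
                (smallFieldOn (shrink L m w : Set (B1Eq324BenfattoLemma.Site d)) I b).indicator (fun _ => (1 : ℝ)) z *
                Real.exp (psi1p s D κ a L w v m z + psi2 s D κ a L w m z) ∂condField d α β (corridors L w B) ξ) ∂P0 d α β := by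
  haveI : IsProbabilityMeasure (P0 d α β) := isProbabilityMeasure_P0 hα hβ
  set err : ℝ := s1Const s D d κ * A * b ^ D *
    (Real.exp (-(κ / 4 * w)) * (corridorsBar L w v B).card + Real.exp (-(κ / 4 * v)) * (B.card * (L : ℝ) ^ d)) with herr
  have hWb : ∀ m, ∀ z : B1Eq324BenfattoLemma.Site d → ℝ, (∀ x ∈ J, x ∈ box L m → |z x| ≤ b) →
      |psi1p s D κ a L w v m z + psi2 s D κ a L w m z| ≤ 8 * (s1Const s D d κ * A * b ^ D * (L : ℝ) ^ d) :=
    fun m z hz => abs_psi1p_add_psi2_le_local hκ hJ hA0 hA hb hz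
  rw [← integral_boxes_factorise_eq hα hβ hκ hJ hA0 hA hJI hL hw B hγ hb (fun m z => psi1p s D κ a L w v m z + psi2 s D κ a L w m z)
    (fun m z z' h => psi1p_add_psi2_congr_eqOn L w v m h) (fun m => measurable_psi1p_add_psi2 L w v m) hWb,
    ← integral_const_mul]
  have hgi := integrable_boxes_integrand hα hβ hκ hJ hA0 hA hJI B hγ hb (fun m z => psi1p s D κ a L w v m z + psi2 s D κ a L w m z)
    (fun m => measurable_psi1p_add_psi2 L w v m) hWb (L := L) (w := w)
  refine integral_mono_of_nonneg (Filter.Eventually.of_forall fun z => mul_nonneg (Real.exp_pos _).le ?_) hgi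
    (Filter.Eventually.of_forall fun z => ?_)
  · rw [cutoffBoltzmann]
    exact Set.indicator_nonneg (fun _ _ => (Real.exp_pos _).le) _
  -- pointwise: on `Π_Δχ̂^{γb}_Δ` every regional cut-off is `1` and `H_{Γ₁} + Σ_□(Ψ′₁ + Ψ₂) ≥ H_{Γ̄₁} − err`
  dsimp only
  have hb0 : (0 : ℝ) ≤ b := zero_le_one.trans hb
  have hγb : γ * b ≤ b := by nlinarith
  by_cases hz : z ∈ smallFieldSet I (γ * b)
  swap
  · rw [cutoffBoltzmann, Set.indicator_of_notMem hz, mul_zero]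
    refine mul_nonneg (mul_nonneg (indicator_smallFieldOn_mem_Icc _ I _ z).1 (Real.exp_pos _).le)
      (mul_nonneg (indicator_smallFieldOn_mem_Icc _ I _ z).1 (Finset.prod_nonneg fun m _ => ?_))
    exact mul_nonneg (mul_nonneg (indicator_smallFieldOn_mem_Icc _ I _ z).1 (indicator_smallFieldOn_mem_Icc _ I _ z).1) (Real.exp_pos _).le
  have i1 : z ∈ smallFieldOn (corridors L w B : Set (B1Eq324BenfattoLemma.Site d)) I (γ * b) := mem_smallFieldOn_of_mem_smallFieldSet le_rfl hz
  have i2 : z ∈ smallFieldOn (out L B) I b := mem_smallFieldOn_of_mem_smallFieldSet hγb hz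
  have i3 : ∀ m : B1Eq324BenfattoLemma.Site d, z ∈ smallFieldOn (frame1 L w m : Set (B1Eq324BenfattoLemma.Site d)) I (γ * b) :=
    fun m => mem_smallFieldOn_of_mem_smallFieldSet le_rfl hz
  have i4 : ∀ m : B1Eq324BenfattoLemma.Site d, z ∈ smallFieldOn (shrink L m w : Set (B1Eq324BenfattoLemma.Site d)) I b :=
    fun m => mem_smallFieldOn_of_mem_smallFieldSet hγb hz
  rw [cutoffBoltzmann, Set.indicator_of_mem hz, Set.indicator_of_mem i1, Set.indicator_of_mem i2, one_mul, one_mul]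
  simp only [Set.indicator_of_mem (i3 _), Set.indicator_of_mem (i4 _), one_mul]
  rw [← Real.exp_sum, ← Real.exp_add, ← Real.exp_add, Real.exp_le_exp]
  -- `|z_Δ| ≤ b` on `J`
  have hzJ : ∀ x ∈ J, |z x| ≤ b := fun x hx => by
    have h := hz x
    rw [distToRegion_eq_zero_of_mem (hJI hx), add_zero, mul_one] at h
    exact h.trans hγb
  have h534 := abs_hamiltonian_corridorsBar_sub_sum_psi_le hκ hJ hA0 hA hL hv hb hzJ (B := B) (s := s) (D := D)
  rw [← herr] at h534
  have := (abs_le.mp h534).2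
  linarith

end Eq535

end Literature.MathematicalPhysics.QuantumFieldTheory.Balaban1983to89.B1Eq324BenfattoSect5Eq535

end
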